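import Mathlib
import HarnessLib
import Summits.MatrixMultiplication.MatrixMultiplication.Theorems.FarEdgeDescentCertTools

/-!
# Far-edge descent — β-slab vertex tools: the criterion's cell test with β as a fifth box variable (model level)

Second input of the β-UNIFORM programme (memo g62 §5.1).  In the coordinates `u = βλ`, `u' = βλ'` the region is
the β-independent box `u, u' ∈ [0, 1]`, and after multiplication by `β² > 0` the endpoint expression of a
criterion cell and the seven region constraints become MULTI-AFFINE in the five variables `(u, u', V, V', β)`:

* `cellExpr5`, `gP5`, `gQm5`, `gQp5`, `gW5`, `cellExprM5` (the scaled forms) with the scaling identities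
  `cellExpr5 … (βλ) (βλ') V V' β = β²·cellExpr β … λ λ' V V'`, `gP5 = β²·gP`, `gQ∓5 = β·gQ∓`, `gW5 = gW`;
* `box5` (a function affine in each of five variables is nonnegative on a box if it is at the 32 vertices,
  vertices supplied as one hypothesis with disjunctions) and `cellExprM5_affine`;
* `cellM5`: the endpoint inequality `A·ca + B·cb ≤ Λ_P(ε+1−V_P)` at every region point with `β ∈ [β₀, β₁]`,
  `βλ ∈ [u₀,u₁]`, `βλ' ∈ [m₀,m₁]`, `V ∈ [V₀,V₁]`, `V' ∈ [W₀,W₁]` from `cellExprM5 ≥ 0` at the 32 vertices and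
  multipliers `μᵢ ≥ 0` (S-procedure), `0 < β`.

MODEL level; no `sorry`, no new axioms.
-/

noncomputable section

set_option linter.dupNamespace false

namespace Summit.MatrixMultiplication.MatrixMultiplication.Theorems.FarEdgeDescentSlabVertex

open Summit.MatrixMultiplication.MatrixMultiplication.Theorems.FarEdgeDescentBoxVertex
open Summit.MatrixMultiplication.MatrixMultiplication.Theorems.FarEdgeDescentCertTools

/-! ## Five-variable box lemma -/

/-- **Five variables**, vertices as one hypothesis: `f` affine in each variable and nonnegative at the 32 vertices
is nonnegative on the box. -/
theorem box5 {f : ℝ → ℝ → ℝ → ℝ → ℝ → ℝ} (hf1 : ∀ b c d e, ∃ p q : ℝ, ∀ t, f t b c d e = p + q * t)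
    (hf2 : ∀ a c d e, ∃ p q : ℝ, ∀ t, f a t c d e = p + q * t)
    (hf3 : ∀ a b d e, ∃ p q : ℝ, ∀ t, f a b t d e = p + q * t)
    (hf4 : ∀ a b c e, ∃ p q : ℝ, ∀ t, f a b c t e = p + q * t)
    (hf5 : ∀ a b c d, ∃ p q : ℝ, ∀ t, f a b c d t = p + q * t) {a₀ a₁ b₀ b₁ c₀ c₁ d₀ d₁ e₀ e₁ : ℝ}
    (hv : ∀ a b c d e : ℝ, (a = a₀ ∨ a = a₁) → (b = b₀ ∨ b = b₁) → (c = c₀ ∨ c = c₁) → (d = d₀ ∨ d = d₁) →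
      (e = e₀ ∨ e = e₁) → 0 ≤ f a b c d e) :
    ∀ a b c d e, a₀ ≤ a → a ≤ a₁ → b₀ ≤ b → b ≤ b₁ → c₀ ≤ c → c ≤ c₁ → d₀ ≤ d → d ≤ d₁ → e₀ ≤ e → e ≤ e₁ →
      0 ≤ f a b c d e := by
  intro a b c d e ha0 ha1 hb0 hb1 hc0 hc1 hd0 hd1 he0 he1
  have slice : ∀ e', (e' = e₀ ∨ e' = e₁) → 0 ≤ f a b c d e' := by
    intro e' he'
    exact box4 (fun b c d => hf1 b c d e') (fun a c d => hf2 a c d e') (fun a b d => hf3 a b d e')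
      (fun a b c => hf4 a b c e')
      (hv _ _ _ _ _ (Or.inl rfl) (Or.inl rfl) (Or.inl rfl) (Or.inl rfl) he')
      (hv _ _ _ _ _ (Or.inl rfl) (Or.inr rfl) (Or.inl rfl) (Or.inl rfl) he')
      (hv _ _ _ _ _ (Or.inr rfl) (Or.inl rfl) (Or.inl rfl) (Or.inl rfl) he')
      (hv _ _ _ _ _ (Or.inr rfl) (Or.inr rfl) (Or.inl rfl) (Or.inl rfl) he')
      (hv _ _ _ _ _ (Or.inl rfl) (Or.inl rfl) (Or.inr rfl) (Or.inl rfl) he')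
      (hv _ _ _ _ _ (Or.inl rfl) (Or.inr rfl) (Or.inr rfl) (Or.inl rfl) he')
      (hv _ _ _ _ _ (Or.inr rfl) (Or.inl rfl) (Or.inr rfl) (Or.inl rfl) he')
      (hv _ _ _ _ _ (Or.inr rfl) (Or.inr rfl) (Or.inr rfl) (Or.inl rfl) he')
      (hv _ _ _ _ _ (Or.inl rfl) (Or.inl rfl) (Or.inl rfl) (Or.inr rfl) he')
      (hv _ _ _ _ _ (Or.inl rfl) (Or.inr rfl) (Or.inl rfl) (Or.inr rfl) he')
      (hv _ _ _ _ _ (Or.inr rfl) (Or.inl rfl) (Or.inl rfl) (Or.inr rfl) he')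
      (hv _ _ _ _ _ (Or.inr rfl) (Or.inr rfl) (Or.inl rfl) (Or.inr rfl) he')
      (hv _ _ _ _ _ (Or.inl rfl) (Or.inl rfl) (Or.inr rfl) (Or.inr rfl) he')
      (hv _ _ _ _ _ (Or.inl rfl) (Or.inr rfl) (Or.inr rfl) (Or.inr rfl) he')
      (hv _ _ _ _ _ (Or.inr rfl) (Or.inl rfl) (Or.inr rfl) (Or.inr rfl) he')
      (hv _ _ _ _ _ (Or.inr rfl) (Or.inr rfl) (Or.inr rfl) (Or.inr rfl) he')
      a b c d ha0 ha1 hb0 hb1 hc0 hc1 hd0 hd1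
  exact box1 (hf5 a b c d) (slice e₀ (Or.inl rfl)) (slice e₁ (Or.inr rfl)) e he0 he1

/-! ## Scaled (five-variable) forms of the cell expression and of the region constraints -/

/-- `β²·cellExpr` in the coordinates `u = βλ`, `u' = βλ'`, with `β = b` a variable. -/
def cellExpr5 (z ε ca cb : ℝ) (u up V W b : ℝ) : ℝ :=
  (u * b + up * b - (2 * b - 1) * u * up) * (ε + 1) -
      (up * b * (1 - u) * W + u * b * (1 - up) * V + z * u * up * V * W) -
    (b - (b - 1) * up) * u * (ε + 1 - V) * ca - (b - (b - 1) * u) * up * (ε + 1 - W) * cb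

/-- `β²·gP` (product floor). -/
def gP5 (z Vmin : ℝ) (u up V W b : ℝ) : ℝ :=
  up * b * (1 - u) * W + u * b * (1 - up) * V + z * u * up * V * W - Vmin * (u * b + up * b - (2 * b - 1) * u * up)

/-- `β·gQm` (chord-relaxed pin, lower sign). -/
def gQm5 (V₀ V₁ : ℝ) (u V b : ℝ) : ℝ := ((V₀ + V₁) * V - V₀ * V₁) * b - b + (2 * b - 1) * u

/-- `β·gQp` (chord-relaxed pin, upper sign). -/
def gQp5 (V₀ V₁ : ℝ) (u V b : ℝ) : ℝ := ((V₀ + V₁) * V - V₀ * V₁) * b - (2 * b - 1) * u + b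

/-- `gW` in the `u`-coordinate (wedge). -/
def gW5 (u V b : ℝ) : ℝ := (b - 1) * V - (2 * b - 1) * u + b

/-- The scaled S-procedure form `cellExpr5 − Σ μᵢ Gᵢ5`. -/
def cellExprM5 (z ε Vmin ca cb V₀ V₁ W₀ W₁ μ₁ μ₂ μ₃ μ₄ μ₅ μ₆ μ₇ : ℝ) (u up V W b : ℝ) : ℝ :=
  cellExpr5 z ε ca cb u up V W b - μ₁ * gP5 z Vmin u up V W b - μ₂ * gQm5 V₀ V₁ u V b -
    μ₃ * gQp5 V₀ V₁ u V b - μ₄ * gQm5 W₀ W₁ up W b - μ₅ * gQp5 W₀ W₁ up W b - μ₆ * gW5 u V b - μ₇ * gW5 up W b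

/-- Scaling identities at `u = βλ`, `u' = βλ'`. -/
theorem scale_ids (β z ε Vmin ca cb V₀ V₁ lam lam' V W : ℝ) :
    cellExpr5 z ε ca cb (β * lam) (β * lam') V W β = β ^ 2 * cellExpr β z ε ca cb lam lam' V W ∧
    gP5 z Vmin (β * lam) (β * lam') V W β = β ^ 2 * gP β z Vmin lam lam' V W ∧
    gQm5 V₀ V₁ (β * lam) V β = β * gQm β V₀ V₁ lam V ∧
    gQp5 V₀ V₁ (β * lam) V β = β * gQp β V₀ V₁ lam V ∧
    gW5 (β * lam) V β = gW β lam V := by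
  refine ⟨?_, ?_, ?_, ?_, ?_⟩
  · simp only [cellExpr5, cellExpr]; ring
  · simp only [gP5, gP]; ring
  · simp only [gQm5, gQm]; ring
  · simp only [gQp5, gQp]; ring
  · simp only [gW5, gW]; ring

/-- `cellExprM5` is affine in each of its five variables. -/
theorem cellExprM5_affine (z ε Vmin ca cb V₀ V₁ W₀ W₁ μ₁ μ₂ μ₃ μ₄ μ₅ μ₆ μ₇ : ℝ) :
    (∀ b c d e, ∃ p q : ℝ, ∀ t,
      cellExprM5 z ε Vmin ca cb V₀ V₁ W₀ W₁ μ₁ μ₂ μ₃ μ₄ μ₅ μ₆ μ₇ t b c d e = p + q * t) ∧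
    (∀ a c d e, ∃ p q : ℝ, ∀ t,
      cellExprM5 z ε Vmin ca cb V₀ V₁ W₀ W₁ μ₁ μ₂ μ₃ μ₄ μ₅ μ₆ μ₇ a t c d e = p + q * t) ∧
    (∀ a b d e, ∃ p q : ℝ, ∀ t,
      cellExprM5 z ε Vmin ca cb V₀ V₁ W₀ W₁ μ₁ μ₂ μ₃ μ₄ μ₅ μ₆ μ₇ a b t d e = p + q * t) ∧
    (∀ a b c e, ∃ p q : ℝ, ∀ t,
      cellExprM5 z ε Vmin ca cb V₀ V₁ W₀ W₁ μ₁ μ₂ μ₃ μ₄ μ₅ μ₆ μ₇ a b c t e = p + q * t) ∧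
    (∀ a b c d, ∃ p q : ℝ, ∀ t,
      cellExprM5 z ε Vmin ca cb V₀ V₁ W₀ W₁ μ₁ μ₂ μ₃ μ₄ μ₅ μ₆ μ₇ a b c d t = p + q * t) := by
  refine ⟨fun b c d e => affine_witness fun t => ?_, fun a c d e => affine_witness fun t => ?_,
    fun a b d e => affine_witness fun t => ?_, fun a b c e => affine_witness fun t => ?_,
    fun a b c d => affine_witness fun t => ?_⟩ <;>
  simp only [cellExprM5, cellExpr5, gP5, gQm5, gQp5, gW5] <;> ring

/-- **Endpoint inequality on a slab box from the 32 vertices (with multipliers).** -/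
theorem cellM5 {z ε Vmin ca cb u₀ u₁ V₀ V₁ m₀ m₁ W₀ W₁ B₀ B₁ μ₁ μ₂ μ₃ μ₄ μ₅ μ₆ μ₇ : ℝ}
    (hμ₁ : 0 ≤ μ₁) (hμ₂ : 0 ≤ μ₂) (hμ₃ : 0 ≤ μ₃) (hμ₄ : 0 ≤ μ₄) (hμ₅ : 0 ≤ μ₅) (hμ₆ : 0 ≤ μ₆) (hμ₇ : 0 ≤ μ₇)
    (hv : ∀ a b c d e : ℝ, (a = u₀ ∨ a = u₁) → (b = m₀ ∨ b = m₁) → (c = V₀ ∨ c = V₁) → (d = W₀ ∨ d = W₁) →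
      (e = B₀ ∨ e = B₁) → 0 ≤ cellExprM5 z ε Vmin ca cb V₀ V₁ W₀ W₁ μ₁ μ₂ μ₃ μ₄ μ₅ μ₆ μ₇ a b c d e)
    {β lam lam' V V' VP : ℝ} (hβ : 0 < β) (e0 : B₀ ≤ β) (e1 : β ≤ B₁)
    (a1 : u₀ ≤ β * lam) (a2 : β * lam ≤ u₁) (a3 : V₀ ≤ V) (a4 : V ≤ V₁) (a5 : m₀ ≤ β * lam')
    (a6 : β * lam' ≤ m₁) (a7 : W₀ ≤ V') (a8 : V' ≤ W₁) (b1 : 0 ≤ lam) (b2 : β * lam ≤ 1) (b3 : 0 ≤ lam')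
    (b4 : β * lam' ≤ 1) (c1 : β * ((2 * β - 1) * lam - 1) ≤ (β - 1) * V)
    (c2 : β * ((2 * β - 1) * lam' - 1) ≤ (β - 1) * V') (c3 : |1 - (2 * β - 1) * lam| ≤ V ^ 2)
    (c4 : |1 - (2 * β - 1) * lam'| ≤ V' ^ 2)
    (hP : VP * (lam + lam' - (2 * β - 1) * lam * lam') =
      lam' * (1 - β * lam) * V' + lam * (1 - β * lam') * V + z * lam * lam' * V * V') (hVP : Vmin ≤ VP) :
    (1 - (β - 1) * lam') * (lam * (ε + 1 - V)) * ca + (1 - (β - 1) * lam) * (lam' * (ε + 1 - V')) * cb ≤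
      (lam + lam' - (2 * β - 1) * lam * lam') * (ε + 1 - VP) := by
  obtain ⟨h1, h2, h3, h4, h5⟩ := cellExprM5_affine z ε Vmin ca cb V₀ V₁ W₀ W₁ μ₁ μ₂ μ₃ μ₄ μ₅ μ₆ μ₇
  have key := box5 h1 h2 h3 h4 h5 hv (β * lam) (β * lam') V V' β a1 a2 a5 a6 a3 a4 a7 a8 e0 e1
  obtain ⟨g1, g2, g3, g4, g5, g6, g7⟩ :=
    constraints_nonneg (z := z) (Vmin := Vmin) (V₀ := V₀) (V₁ := V₁) (W₀ := W₀) (W₁ := W₁)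
      b1 b2 b3 b4 a3 a4 a7 a8 c1 c2 c3 c4 hP hVP
  obtain ⟨s1, s2, s3, s4, s5⟩ := scale_ids β z ε Vmin ca cb V₀ V₁ lam lam' V V'
  obtain ⟨-, -, s3', s4', s5'⟩ := scale_ids β z ε Vmin ca cb W₀ W₁ lam' lam V' V
  have eM : cellExprM5 z ε Vmin ca cb V₀ V₁ W₀ W₁ μ₁ μ₂ μ₃ μ₄ μ₅ μ₆ μ₇ (β * lam) (β * lam') V V' β =
      β ^ 2 * cellExpr β z ε ca cb lam lam' V V' -
        (μ₁ * (β ^ 2 * gP β z Vmin lam lam' V V') + μ₂ * (β * gQm β V₀ V₁ lam V) +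
          μ₃ * (β * gQp β V₀ V₁ lam V) + μ₄ * (β * gQm β W₀ W₁ lam' V') + μ₅ * (β * gQp β W₀ W₁ lam' V') +
          μ₆ * gW β lam V + μ₇ * gW β lam' V') := by
    simp only [cellExprM5]; rw [s1, s2, s3, s4, s5, s3', s4', s5']; ring
  have eC : cellExpr β z ε ca cb lam lam' V V' =
      (lam + lam' - (2 * β - 1) * lam * lam') * (ε + 1 - VP) -
        ((1 - (β - 1) * lam') * (lam * (ε + 1 - V)) * ca +
          (1 - (β - 1) * lam) * (lam' * (ε + 1 - V')) * cb) := by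
    simp only [cellExpr]; linear_combination hP
  have hb2 : 0 < β ^ 2 := by positivity
  have m1 := mul_nonneg hμ₁ (mul_nonneg hb2.le g1)
  have m2 := mul_nonneg hμ₂ (mul_nonneg hβ.le g2)
  have m3 := mul_nonneg hμ₃ (mul_nonneg hβ.le g3)
  have m4 := mul_nonneg hμ₄ (mul_nonneg hβ.le g4)
  have m5 := mul_nonneg hμ₅ (mul_nonneg hβ.le g5)
  have m6 := mul_nonneg hμ₆ g6
  have m7 := mul_nonneg hμ₇ g7
  have hX : 0 ≤ β ^ 2 * cellExpr β z ε ca cb lam lam' V V' := by linarith [key, eM]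
  have hX' : 0 ≤ cellExpr β z ε ca cb lam lam' V V' := (mul_nonneg_iff_of_pos_left hb2).mp hX
  linarith [hX', eC]

end Summit.MatrixMultiplication.MatrixMultiplication.Theorems.FarEdgeDescentSlabVertex
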